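import Summits.RiemannHypothesis.RiemannHypothesis.Theorems.PfPersistenceM2OddSectorAnnihilators
import HarnessLib

/-!
# Pf-persistence index route (M2), odd sector at `K = ∞`, part 2/3: the odd negative-definite engine

Long-odds MECHANISM SEARCH (cell `pub-rhpf`, seat M2); every result here is RH-free and makes no
claim about RH.  Notation: `Q(g) = weilQuadratic g`, `ĝ = weilMellin g`,
`𝒵_θ = {ρ : ζ(ρ) = 0 non-trivial, Re ρ ≥ 1/2 + θ, Im ρ > 0}` (possibly INFINITE),
(QA_θ) = `QuadrantAnnihilable θ` (an unconditional theorem for every `θ > 0`,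
`quadrantAnnihilable_pos`; kept as a binder here so that this file is hypothesis-transparent).

PROVED here (RH-free): `exists_negative_definite_odd_family_of_annihilable` — `θ > 0`, (QA_θ),
`n ≤ #𝒵_θ` in `ℕ∞` ⟹ a window `A` and `n` ODD, real-valued Weil tests in `[-A, A]` on whose real span
`Re Q` is NEGATIVE DEFINITE.  The proof is the even engine
(`PfPersistenceM2EvenSectorAnnihilation.exists_negative_definite_even_family_of_annihilable`) with
the parity signs swapped, exactly as in the cand-7 seat's finite-`K` odd engine
(`PfPersistenceTwoParityIndexOddLower.exists_negative_definite_odd_family_of_finite`): the odd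
annihilating tests of part 1 (`ψ̂ᵢ = [ρ = eᵢ]` on `𝒵_θ`, value `1` REAL), symmetric translates tuned
to `Tᵢ ∈ (2π/γᵢ)ℕ` so that `ĝᵢ(eᵢ) = cosh(δᵢTᵢ)` is real; for odd real `G`, `P_G = -Ĝ²`, so
`Re Q(G) = Σ m (Im Ĝ)² - Σ m (Re Ĝ)²`; the positive part is controlled by the near-bystander weights
`cosh²(xTᵢ)/cosh²(θT) → 0` (Tannery) and vanishes at distance `≥ θ` by the odd transport
`im_weilMellin_eq_zero_of_far_odd`; the negative part is `≥ (Σcᵢ²) cosh²(θT)` from the tuned zeros.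
[CITED shape: Bombieri 2000, Rend. Lincei (9) 11, Thm 9 (odd part) / Thm 11.]
-/

noncomputable section

set_option linter.dupNamespace false

open Complex Filter Set MeasureTheory
open scoped Real Topology ComplexConjugate BigOperators

namespace Summit.RiemannHypothesis.RiemannHypothesis.Theorems.PfPersistenceM2NegIndex

open Literature.NumberTheory.LFunctions
open Literature.NumberTheory.LFunctions.WeilConverse
open Literature.NumberTheory.LFunctions.ZetaZeros
open Summit.RiemannHypothesis.RiemannHypothesis.Theorems.RuelleBandExactFirstBand
  (pairCoeff_of_odd_real isWeilTest_symTranslate symTranslate_odd symTranslate_im weilMellin_symTranslate)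

/-- **MAIN: negative ODD index `≥ n` from ANY `n` zeros at real-part distance `≥ θ`, modulo
annihilation.**  `θ > 0`, `QuadrantAnnihilable θ`, `n ≤ #𝒵_θ` in `ℕ∞` (`𝒵_θ` may be infinite; zeros
with `1/2 < Re ρ < 1/2 + θ` unrestricted) ⟹ a window `A` and `n` odd, real-valued Weil tests in
`[-A, A]` with `Re Q(Σ cᵢ gᵢ) < 0` for every real `c ≠ 0`.
[cite: Bombieri2000Weil, Thm 9 (odd part); Thm 11] -/
theorem exists_negative_definite_odd_family_of_annihilable {θ : ℝ} (hθ : 0 < θ)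
    (hann : QuadrantAnnihilable θ) {n : ℕ}
    (hn : (n : ℕ∞) ≤ {ρ : ℂ | ρ ∈ riemannZetaNontrivialZeros ∧ 1 / 2 + θ ≤ ρ.re ∧ 0 < ρ.im}.encard) :
    ∃ A : ℝ, ∃ g : Fin n → ℝ → ℂ, (∀ i, IsWeilTest (g i)) ∧ (∀ i (t : ℝ), g i (-t) = -g i t) ∧
      (∀ i (t : ℝ), (g i t).im = 0) ∧ (∀ i, tsupport (g i) ⊆ Icc (-A) A) ∧
      ∀ c : Fin n → ℝ, c ≠ 0 → (weilQuadratic (fun t : ℝ ↦ ∑ i, (c i : ℂ) * g i t)).re < 0 := by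
  classical
  have hZall : ∀ ρ ∈ riemannZetaNontrivialZeros, 1 / 2 + θ ≤ ρ.re → 0 < ρ.im →
      ρ ∈ {ρ : ℂ | ρ ∈ riemannZetaNontrivialZeros ∧ 1 / 2 + θ ≤ ρ.re ∧ 0 < ρ.im} :=
    fun ρ hρ h1 h2 ↦ ⟨hρ, h1, h2⟩
  -- `n` distinct zeros `e i` with `Re (e i) - 1/2 ≥ θ`, `Im (e i) > 0`
  obtain ⟨F, hFsub, hFcard⟩ := exists_subset_encard_eq hn
  have hFfin : F.Finite := finite_of_encard_eq_coe hFcard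
  have hcardF : n ≤ hFfin.toFinset.card := by
    have h1 := hFfin.encard_eq_coe_toFinset_card; rw [hFcard] at h1; exact_mod_cast h1.le
  let e : Fin n → ℂ := fun i ↦ (hFfin.toFinset.equivFin.symm (Fin.castLE hcardF i) : ℂ)
  have he_memF : ∀ i, e i ∈ F := fun i ↦
    hFfin.mem_toFinset.1 (hFfin.toFinset.equivFin.symm (Fin.castLE hcardF i)).2
  have he_mem : ∀ i, e i ∈ riemannZetaNontrivialZeros ∧ 1 / 2 + θ ≤ (e i).re ∧ 0 < (e i).im :=
    fun i ↦ hFsub (he_memF i)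
  have he_inj : Function.Injective e := fun i j h ↦
    Fin.castLE_injective hcardF (hFfin.toFinset.equivFin.symm.injective (Subtype.ext h))
  have he_ntz : ∀ i, e i ∈ riemannZetaNontrivialZeros := fun i ↦ (he_mem i).1
  have hδ : ∀ i, θ ≤ (e i).re - 1 / 2 := fun i ↦ by linarith [(he_mem i).2.1]
  have hγ : ∀ i, 0 < (e i).im := fun i ↦ (he_mem i).2.2
  -- Step 1: ODD annihilating unit tests `φ i` with `φ̂ᵢ = [ρ = e i]` on `𝒵_θ` (part 1, from (QA_θ))
  have hφ : ∀ i : Fin n, ∃ φ : ℝ → ℂ, ∃ b : ℝ, IsWeilTest φ ∧ (∀ t : ℝ, φ (-t) = -φ t) ∧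
      (∀ t : ℝ, (φ t).im = 0) ∧ tsupport φ ⊆ Icc (-b) b ∧
      ∀ ρ ∈ riemannZetaNontrivialZeros, 1 / 2 + θ ≤ ρ.re → 0 < ρ.im →
        weilMellin φ ρ = if ρ = e i then 1 else 0 := fun i ↦
    exists_oddRealTest_indicator_of_annihilable hθ hann (he_mem i)
  choose φ b hφt hφe hφr hφs hφv using hφ
  set B : ℝ := ∑ i, |b i| with hBdef
  have hbB : ∀ i, b i ≤ B := fun i ↦ (le_abs_self (b i)).trans
    (Finset.single_le_sum (f := fun j ↦ |b j|) (fun j _ ↦ abs_nonneg (b j)) (Finset.mem_univ i))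
  -- Step 2: normalised bystander weights `U ρ T ∈ [0, 1]`, `→ 0`, and the normalised bystander sums
  set U : riemannZetaNontrivialZeros → ℝ → ℝ := fun ρ T ↦
    if |(ρ : ℂ).re - 1 / 2| < θ then
      (Real.cosh (((ρ : ℂ).re - 1 / 2) * T) / Real.cosh (θ * T)) ^ 2 else 0 with hUdef
  have hU0 : ∀ ρ T, 0 ≤ U ρ T := fun ρ T ↦ by simp only [hUdef]; split_ifs <;> positivity
  have hU1 : ∀ ρ T, U ρ T ≤ 1 := fun ρ T ↦ by
    simp only [hUdef]
    split_ifs with h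
    · have hc : Real.cosh (((ρ : ℂ).re - 1 / 2) * T) ≤ Real.cosh (θ * T) :=
        Real.cosh_le_cosh.2 (by
          rw [abs_mul, abs_mul, abs_of_nonneg hθ.le]
          exact mul_le_mul_of_nonneg_right h.le (abs_nonneg T))
      have hr : Real.cosh (((ρ : ℂ).re - 1 / 2) * T) / Real.cosh (θ * T) ≤ 1 :=
        (div_le_one (Real.cosh_pos _)).2 hc
      have hr0 : 0 ≤ Real.cosh (((ρ : ℂ).re - 1 / 2) * T) / Real.cosh (θ * T) :=
        div_nonneg (Real.cosh_pos _).le (Real.cosh_pos _).le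
      nlinarith
    · exact zero_le_one
  have hUlim : ∀ ρ, Tendsto (U ρ) atTop (𝓝 0) := fun ρ ↦ by
    by_cases h : |(ρ : ℂ).re - 1 / 2| < θ
    · simp only [hUdef, if_pos h]
      simpa using (tendsto_cosh_div_cosh_atTop h).pow 2
    · simp only [hUdef, if_neg h]; exact tendsto_const_nhds
  set f : Fin n → ℝ → riemannZetaNontrivialZeros → ℝ := fun i T ρ ↦
    ‖(riemannZetaZeroOrder (ρ : ℂ) : ℂ) * pairCoeff (φ i) ρ‖ * U ρ T with hfdef
  have hf0 : ∀ i T ρ, 0 ≤ f i T ρ := fun i T ρ ↦ mul_nonneg (norm_nonneg _) (hU0 ρ T)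
  have hfle : ∀ i T ρ, f i T ρ ≤ ‖(riemannZetaZeroOrder (ρ : ℂ) : ℂ) * pairCoeff (φ i) ρ‖ :=
    fun i T ρ ↦ mul_le_of_le_one_right (norm_nonneg _) (hU1 ρ T)
  have hfsum : ∀ i T, Summable (f i T) := fun i T ↦
    Summable.of_nonneg_of_le (hf0 i T) (hfle i T) (summable_norm_pairCoeff (hφt i))
  have hlim : ∀ i, Tendsto (fun T ↦ ∑' ρ, f i T ρ) atTop (𝓝 0) := fun i ↦ by
    have h := tendsto_tsum_of_dominated_convergence (𝓕 := atTop) (f := f i) (g := fun _ ↦ (0 : ℝ))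
      (bound := fun ρ ↦ ‖(riemannZetaZeroOrder (ρ : ℂ) : ℂ) * pairCoeff (φ i) ρ‖)
      (summable_norm_pairCoeff (hφt i))
      (fun ρ ↦ by
        simpa [hfdef] using
          (hUlim ρ).const_mul ‖(riemannZetaZeroOrder (ρ : ℂ) : ℂ) * pairCoeff (φ i) ρ‖)
      (Eventually.of_forall fun T ρ ↦ by
        rw [Real.norm_of_nonneg (hf0 i T ρ)]
        exact hfle i T ρ)
    simpa using h
  -- Step 3: the spread `C = Σ 2π/γᵢ`, `E = e^{θC}`, `ε = 1/(E²(n+1))`, and the base length `T`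
  set C : ℝ := ∑ i, 2 * π / (e i).im with hCdef
  have hCi : ∀ i, 2 * π / (e i).im ≤ C := fun i ↦
    Finset.single_le_sum (f := fun j ↦ 2 * π / (e j).im)
      (fun j _ ↦ (div_pos Real.two_pi_pos (hγ j)).le) (Finset.mem_univ i)
  set E : ℝ := Real.exp (θ * C) with hEdef
  have hEpos : 0 < E := Real.exp_pos _
  set ε : ℝ := (E ^ 2 * (n + 1))⁻¹ with hεdef
  have hεpos : 0 < ε := by simp only [hεdef]; positivity
  have hev : ∀ᶠ T in atTop, ∀ i, ∑' ρ, f i T ρ < ε :=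
    eventually_all.2 fun i ↦ (hlim i).eventually_lt_const hεpos
  obtain ⟨T₀, hT₀⟩ := eventually_atTop.1 hev
  set T : ℝ := max T₀ 0 with hTdef
  have hT0 : 0 ≤ T := le_max_right _ _
  have hTT₀ : T₀ ≤ T := le_max_left _ _
  -- Step 4: TUNED lengths `Tᵢ ∈ (2π/γᵢ)ℕ ∩ [T, T + C]`
  have hTi : ∀ i, ∃ T' : ℝ, T ≤ T' ∧ T' ≤ T + C ∧ ∃ k : ℕ, (e i).im * T' = 2 * π * k := by
    intro i
    have h2π : 0 < 2 * π := Real.two_pi_pos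
    have hk1 : (e i).im * T / (2 * π) ≤ ⌈(e i).im * T / (2 * π)⌉₊ := Nat.le_ceil _
    have hk2 : (⌈(e i).im * T / (2 * π)⌉₊ : ℝ) < (e i).im * T / (2 * π) + 1 :=
      Nat.ceil_lt_add_one (div_nonneg (mul_nonneg (hγ i).le hT0) h2π.le)
    have hk3 := mul_lt_mul_of_pos_right hk2 h2π
    rw [add_mul, div_mul_cancel₀ _ h2π.ne', one_mul] at hk3
    have hk4 := (div_le_iff₀ h2π).1 hk1
    refine ⟨2 * π * ⌈(e i).im * T / (2 * π)⌉₊ / (e i).im, ?_, ?_, ⌈(e i).im * T / (2 * π)⌉₊, ?_⟩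
    · rw [le_div_iff₀ (hγ i)]; linarith
    · have h3 : 2 * π * ⌈(e i).im * T / (2 * π)⌉₊ / (e i).im ≤ T + 2 * π / (e i).im := by
        rw [div_le_iff₀ (hγ i), add_mul, div_mul_cancel₀ _ (hγ i).ne']
        linarith
      linarith [hCi i]
    · rw [mul_div_assoc', mul_div_cancel_left₀ _ (hγ i).ne']
  choose Tn hTle hTleC hTk using hTi
  have hTn0 : ∀ i, 0 ≤ Tn i := fun i ↦ hT0.trans (hTle i)
  -- Step 5: the family: symmetric translates `g i` of the `φ i` by `Tn i`; window `A = B + T + C`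
  set g : Fin n → ℝ → ℂ := fun i t ↦ (φ i (t - Tn i) + φ i (t + Tn i)) / 2 with hgdef
  have hgt : ∀ i, IsWeilTest (g i) := fun i ↦ isWeilTest_symTranslate (hφt i) (Tn i)
  have hge : ∀ i (t : ℝ), g i (-t) = -g i t := fun i t ↦ symTranslate_odd (hφe i) (Tn i) t
  have hgr : ∀ i (t : ℝ), (g i t).im = 0 := fun i t ↦ symTranslate_im (hφr i) (Tn i) t
  have hgm : ∀ i (s : ℂ), weilMellin (g i) s =
      weilMellin (φ i) s * ((cexp ((s - 1 / 2) * Tn i) + cexp (-((s - 1 / 2) * Tn i))) / 2) :=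
    fun i s ↦ weilMellin_symTranslate (hφt i) (Tn i) s
  refine ⟨B + (T + C), g, hgt, hge, hgr, fun i ↦ ?_, fun c hc ↦ ?_⟩
  · refine (tsupport_symTranslate_subset (hφs i) (hTn0 i)).trans (Icc_subset_Icc ?_ ?_) <;>
      linarith [hTleC i, hbB i]
  -- Step 6: `G = Σ cᵢ gᵢ` (odd, real); `Re Q(G) = Σ m X² - Σ m Y²`, `X = Im Ĝ`, `Y = Re Ĝ` (`P_G = -Ĝ²`)
  have hGtest : IsWeilTest (fun t : ℝ ↦ ∑ i, (c i : ℂ) * g i t) :=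
    isWeilTest_finset_sum Finset.univ fun i _ ↦ (hgt i).const_mul (c i)
  have hGodd : ∀ t : ℝ, (fun t : ℝ ↦ ∑ i, (c i : ℂ) * g i t) (-t) =
      -(fun t : ℝ ↦ ∑ i, (c i : ℂ) * g i t) t := fun t ↦ by
    simp only [hge, mul_neg, Finset.sum_neg_distrib]
  have hGreal : ∀ t : ℝ, ((fun t : ℝ ↦ ∑ i, (c i : ℂ) * g i t) t).im = 0 := fun t ↦ by
    simp [Complex.im_sum, Complex.mul_im, hgr]
  have hGmellin : ∀ s : ℂ, weilMellin (fun t : ℝ ↦ ∑ i, (c i : ℂ) * g i t) s =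
      ∑ i, (c i : ℂ) * weilMellin (g i) s := fun s ↦ by
    have h := weilMellin_finset_sum Finset.univ (f := fun i (t : ℝ) ↦ (c i : ℂ) * g i t)
      (fun i _ ↦ (hgt i).const_mul (c i)) s
    simpa only [weilMellin_const_mul] using h
  set G : ℝ → ℂ := fun t : ℝ ↦ ∑ i, (c i : ℂ) * g i t with hGdef
  have hQ : zeroForm G = weilQuadratic G :=
    tendsto_nhds_unique (hasWeilZeroSide_zeroForm hGtest)
      (explicit_formula_holds (hGtest.weilConv hGtest.weilReflect))
  have hm0 : ∀ ρ : riemannZetaNontrivialZeros, (0 : ℝ) ≤ (riemannZetaZeroOrder (ρ : ℂ) : ℝ) := fun ρ ↦ by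
    have h0 : (0 : ℤ) ≤ riemannZetaZeroOrder (ρ : ℂ) :=
      le_trans zero_le_one (riemannZetaNontrivialZeros.one_le_order ρ.2)
    exact_mod_cast h0
  have hm1 : ∀ ρ : riemannZetaNontrivialZeros, (1 : ℝ) ≤ (riemannZetaZeroOrder (ρ : ℂ) : ℝ) := fun ρ ↦ by
    exact_mod_cast riemannZetaNontrivialZeros.one_le_order ρ.2
  set X : riemannZetaNontrivialZeros → ℝ := fun ρ ↦ (weilMellin G ρ).im with hXdef
  set Y : riemannZetaNontrivialZeros → ℝ := fun ρ ↦ (weilMellin G ρ).re with hYdef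
  have hterm : ∀ ρ : riemannZetaNontrivialZeros, ((riemannZetaZeroOrder (ρ : ℂ) : ℂ) * pairCoeff G ρ).re =
      (riemannZetaZeroOrder (ρ : ℂ) : ℝ) * X ρ ^ 2 - (riemannZetaZeroOrder (ρ : ℂ) : ℝ) * Y ρ ^ 2 :=
    fun ρ ↦ by
      rw [pairCoeff_of_odd_real hGodd hGreal]
      simp only [Complex.mul_re, Complex.neg_re, Complex.neg_im, Complex.mul_im, Complex.intCast_re,
        Complex.intCast_im, hXdef, hYdef]
      ring
  have hnorm : ∀ ρ : riemannZetaNontrivialZeros, ‖(riemannZetaZeroOrder (ρ : ℂ) : ℂ) * pairCoeff G ρ‖ =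
      (riemannZetaZeroOrder (ρ : ℂ) : ℝ) * (X ρ ^ 2 + Y ρ ^ 2) := fun ρ ↦ by
    rw [norm_mul, Complex.norm_intCast, pairCoeff_of_odd_real hGodd hGreal, norm_neg, norm_mul, ← sq,
      Complex.sq_norm, Complex.normSq_apply, abs_of_nonneg (hm0 ρ)]
    simp only [hXdef, hYdef]
    ring
  have hsumN := summable_norm_pairCoeff hGtest
  have hsumX : Summable fun ρ : riemannZetaNontrivialZeros ↦ (riemannZetaZeroOrder (ρ : ℂ) : ℝ) * X ρ ^ 2 :=
    Summable.of_nonneg_of_le (fun ρ ↦ mul_nonneg (hm0 ρ) (sq_nonneg _))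
      (fun ρ ↦ by rw [hnorm]; nlinarith [hm0 ρ, sq_nonneg (Y ρ)]) hsumN
  have hsumY : Summable fun ρ : riemannZetaNontrivialZeros ↦ (riemannZetaZeroOrder (ρ : ℂ) : ℝ) * Y ρ ^ 2 :=
    Summable.of_nonneg_of_le (fun ρ ↦ mul_nonneg (hm0 ρ) (sq_nonneg _))
      (fun ρ ↦ by rw [hnorm]; nlinarith [hm0 ρ, sq_nonneg (X ρ)]) hsumN
  have hre : (weilQuadratic G).re =
      ∑' ρ : riemannZetaNontrivialZeros, (riemannZetaZeroOrder (ρ : ℂ) : ℝ) * X ρ ^ 2 -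
        ∑' ρ : riemannZetaNontrivialZeros, (riemannZetaZeroOrder (ρ : ℂ) : ℝ) * Y ρ ^ 2 := by
    rw [← hQ, zeroForm, Complex.re_tsum (summable_pairCoeff hGtest), ← hsumX.tsum_sub hsumY]
    exact tsum_congr hterm
  -- Step 7: the positive part is `≤ S · n · E² ε · cosh²(θT) < S cosh²(θT)`, `S = Σ cᵢ²`
  set S : ℝ := ∑ i, c i ^ 2 with hSdef
  have hSpos : 0 < S := by
    obtain ⟨i, hi⟩ : ∃ i, c i ≠ 0 := Function.ne_iff.1 hc
    have h1 : c i ^ 2 ≤ S :=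
      Finset.single_le_sum (f := fun j ↦ c j ^ 2) (fun j _ ↦ sq_nonneg (c j)) (Finset.mem_univ i)
    linarith [lt_of_le_of_ne (sq_nonneg _) (Ne.symm (pow_ne_zero 2 hi))]
  -- per-zero domination: `(Im ĝᵢ(ρ))² ≤ ‖φ̂ᵢ(ρ)‖² cosh²(θTᵢ) U(ρ, Tᵢ)` (near the line: `|factor| ≤ cosh(xTᵢ)`;
  -- at distance `≥ θ`: `Im ĝᵢ(ρ) = 0`, odd transport)
  have hReg : ∀ i (ρ : riemannZetaNontrivialZeros),
      (weilMellin (g i) ρ).im ^ 2 ≤ ‖weilMellin (φ i) ρ‖ ^ 2 * (Real.cosh (θ * Tn i) ^ 2 * U ρ (Tn i)) := by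
    intro i ρ
    by_cases hnear : |(ρ : ℂ).re - 1 / 2| < θ
    · have hne : Real.cosh (θ * Tn i) ^ 2 ≠ 0 := (pow_pos (Real.cosh_pos _) 2).ne'
      have hU : Real.cosh (θ * Tn i) ^ 2 * U ρ (Tn i) = Real.cosh (((ρ : ℂ).re - 1 / 2) * Tn i) ^ 2 := by
        simp only [hUdef, if_pos hnear, div_pow]
        rw [mul_div_assoc', mul_div_cancel_left₀ _ hne]
      calc (weilMellin (g i) ρ).im ^ 2 ≤ ‖weilMellin (g i) ρ‖ ^ 2 := by
            rw [Complex.sq_norm, Complex.normSq_apply]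
            nlinarith [sq_nonneg (weilMellin (g i) ρ).re]
        _ ≤ ‖weilMellin (φ i) ρ‖ ^ 2 * Real.cosh (((ρ : ℂ).re - 1 / 2) * Tn i) ^ 2 := by
          rw [hgm, norm_mul, mul_pow]
          exact mul_le_mul_of_nonneg_left
            (pow_le_pow_left₀ (norm_nonneg _) (norm_coshFactor_le_cosh (ρ : ℂ) (Tn i)) 2) (sq_nonneg _)
        _ = ‖weilMellin (φ i) ρ‖ ^ 2 * (Real.cosh (θ * Tn i) ^ 2 * U ρ (Tn i)) := by rw [hU]
    · have hvan : ∀ ρ' ∈ {ρ : ℂ | ρ ∈ riemannZetaNontrivialZeros ∧ 1 / 2 + θ ≤ ρ.re ∧ 0 < ρ.im},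
          (weilMellin (g i) ρ').im = 0 := by
        intro ρ' hρ'
        rw [hgm, hφv i ρ' hρ'.1 hρ'.2.1 hρ'.2.2]
        split_ifs with h
        · obtain ⟨k, hk⟩ := hTk i
          rw [h, coshFactor_eq_of_tuned hk]
          simp only [Complex.ofReal_im, one_mul]
        · simp
      rw [im_weilMellin_eq_zero_of_far_odd (hge i) (hgr i) hZall hvan ρ.2 (not_lt.1 hnear), sq,
        mul_zero]
      exact mul_nonneg (sq_nonneg _) (mul_nonneg (sq_nonneg _) (hU0 _ _))
  set P : riemannZetaNontrivialZeros → ℝ := fun ρ ↦ ∑ i, Real.cosh (θ * Tn i) ^ 2 * f i (Tn i) ρ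
    with hPdef
  have hsumP : Summable P := summable_sum fun i _ ↦ (hfsum i (Tn i)).mul_left _
  have hPtsum : ∑' ρ, P ρ = ∑ i, Real.cosh (θ * Tn i) ^ 2 * ∑' ρ, f i (Tn i) ρ := by
    have h1 : ∑' ρ, P ρ = ∑ i, ∑' ρ, Real.cosh (θ * Tn i) ^ 2 * f i (Tn i) ρ :=
      Summable.tsum_finsetSum fun i _ ↦ (hfsum i (Tn i)).mul_left _
    rw [h1]
    exact Finset.sum_congr rfl fun i _ ↦ tsum_mul_left
  have hXb : ∀ ρ : riemannZetaNontrivialZeros, (riemannZetaZeroOrder (ρ : ℂ) : ℝ) * X ρ ^ 2 ≤ S * P ρ := by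
    intro ρ
    have hXeq : X ρ = ∑ i, c i * (weilMellin (g i) ρ).im := by
      simp only [hXdef, hGmellin, Complex.im_sum, Complex.im_ofReal_mul]
    have h1 : X ρ ^ 2 ≤ S * ∑ i, (weilMellin (g i) ρ).im ^ 2 := by
      rw [hXeq]
      exact Finset.sum_mul_sq_le_sq_mul_sq Finset.univ c fun i ↦ (weilMellin (g i) ρ).im
    have h2 : ∑ i, (weilMellin (g i) ρ).im ^ 2 ≤
        ∑ i, ‖weilMellin (φ i) ρ‖ ^ 2 * (Real.cosh (θ * Tn i) ^ 2 * U ρ (Tn i)) :=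
      Finset.sum_le_sum fun i _ ↦ hReg i ρ
    have h3 : (riemannZetaZeroOrder (ρ : ℂ) : ℝ) *
        ∑ i, ‖weilMellin (φ i) (ρ : ℂ)‖ ^ 2 * (Real.cosh (θ * Tn i) ^ 2 * U ρ (Tn i)) = P ρ := by
      simp only [hPdef, hfdef, Finset.mul_sum]
      refine Finset.sum_congr rfl fun i _ ↦ ?_
      rw [norm_mul, Complex.norm_intCast, pairCoeff_of_odd_real (hφe i) (hφr i), norm_neg, norm_mul,
        ← sq, abs_of_nonneg (hm0 ρ)]
      ring
    calc (riemannZetaZeroOrder (ρ : ℂ) : ℝ) * X ρ ^ 2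
        ≤ (riemannZetaZeroOrder (ρ : ℂ) : ℝ) * (S * ∑ i, (weilMellin (g i) ρ).im ^ 2) :=
          mul_le_mul_of_nonneg_left h1 (hm0 ρ)
      _ ≤ (riemannZetaZeroOrder (ρ : ℂ) : ℝ) *
            (S * ∑ i, ‖weilMellin (φ i) ρ‖ ^ 2 * (Real.cosh (θ * Tn i) ^ 2 * U ρ (Tn i))) :=
          mul_le_mul_of_nonneg_left (mul_le_mul_of_nonneg_left h2 hSpos.le) (hm0 ρ)
      _ = S * P ρ := by rw [← h3]; ring
  have hB : ∀ i, ∑' ρ, f i (Tn i) ρ < ε := fun i ↦ hT₀ (Tn i) (hTT₀.trans (hTle i)) i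
  have hB0 : ∀ i, 0 ≤ ∑' ρ, f i (Tn i) ρ := fun i ↦ tsum_nonneg (hf0 i (Tn i))
  have hcoshT : ∀ i, Real.cosh (θ * Tn i) ^ 2 ≤ E ^ 2 * Real.cosh (θ * T) ^ 2 := fun i ↦ by
    have h1 : Real.cosh (θ * Tn i) ≤ E * Real.cosh (θ * T) := by
      rw [show θ * Tn i = θ * T + θ * (Tn i - T) by ring]
      refine (cosh_add_le_exp_mul_cosh _ (mul_nonneg hθ.le (sub_nonneg.2 (hTle i)))).trans ?_
      refine mul_le_mul_of_nonneg_right ?_ (Real.cosh_pos _).le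
      exact Real.exp_le_exp.2 (mul_le_mul_of_nonneg_left (by linarith [hTleC i]) hθ.le)
    rw [← mul_pow]
    exact pow_le_pow_left₀ (Real.cosh_pos _).le h1 2
  have hXsum : ∑' ρ : riemannZetaNontrivialZeros, (riemannZetaZeroOrder (ρ : ℂ) : ℝ) * X ρ ^ 2 ≤
      S * ((n : ℝ) * (E ^ 2 * Real.cosh (θ * T) ^ 2 * ε)) := by
    calc ∑' ρ : riemannZetaNontrivialZeros, (riemannZetaZeroOrder (ρ : ℂ) : ℝ) * X ρ ^ 2
        ≤ ∑' ρ, S * P ρ := hsumX.tsum_le_tsum hXb (hsumP.mul_left S)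
      _ = S * ∑ i, Real.cosh (θ * Tn i) ^ 2 * ∑' ρ, f i (Tn i) ρ := by rw [tsum_mul_left, hPtsum]
      _ ≤ S * ∑ _i : Fin n, E ^ 2 * Real.cosh (θ * T) ^ 2 * ε := by
          refine mul_le_mul_of_nonneg_left (Finset.sum_le_sum fun i _ ↦ ?_) hSpos.le
          exact mul_le_mul (hcoshT i) (hB i).le (hB0 i) (by positivity)
      _ = S * ((n : ℝ) * (E ^ 2 * Real.cosh (θ * T) ^ 2 * ε)) := by
          rw [Finset.sum_const, Finset.card_univ, Fintype.card_fin, nsmul_eq_mul]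
  have hnε : (n : ℝ) * (E ^ 2 * Real.cosh (θ * T) ^ 2 * ε) < Real.cosh (θ * T) ^ 2 := by
    have h1 : (n : ℝ) * (E ^ 2 * ε) < 1 := by
      rw [hεdef, mul_inv, ← mul_assoc (E ^ 2), mul_inv_cancel₀ (pow_ne_zero 2 hEpos.ne'), one_mul,
        ← div_eq_mul_inv, div_lt_one (by positivity)]
      linarith
    have h2 : 0 < Real.cosh (θ * T) ^ 2 := pow_pos (Real.cosh_pos _) 2
    nlinarith
  -- Step 8: the negative part is `≥ S cosh²(θT)`, from the `n` tuned zeros `e i` alone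
  set κ : Fin n → ℝ := fun i ↦
    (Real.exp (((e i).re - 1 / 2) * Tn i) + Real.exp (-(((e i).re - 1 / 2) * Tn i))) / 2 with hκdef
  have hκ1 : ∀ i, Real.cosh (θ * T) ≤ κ i := fun i ↦ by
    have h1 : κ i = Real.cosh (((e i).re - 1 / 2) * Tn i) := by simp only [hκdef]; rw [Real.cosh_eq]
    rw [h1]
    refine Real.cosh_le_cosh.2 ?_
    rw [abs_of_nonneg (mul_nonneg hθ.le hT0), abs_of_nonneg (mul_nonneg (hθ.le.trans (hδ i)) (hTn0 i))]
    exact mul_le_mul (hδ i) (hTle i) hT0 (hθ.le.trans (hδ i))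
  have hGei : ∀ i, weilMellin G (e i) = (c i : ℂ) * (1 * (κ i : ℂ)) := fun i ↦ by
    rw [hGmellin, Finset.sum_eq_single i]
    · obtain ⟨k, hk⟩ := hTk i
      rw [hgm, hφv i (e i) (he_mem i).1 (he_mem i).2.1 (he_mem i).2.2, if_pos rfl, coshFactor_eq_of_tuned hk]
    · intro j _ hji
      rw [hgm, hφv j (e i) (he_mem i).1 (he_mem i).2.1 (he_mem i).2.2,
        if_neg (fun h ↦ hji (he_inj h).symm)]
      simp
    · exact fun h ↦ absurd (Finset.mem_univ i) h
  let ez : Fin n → riemannZetaNontrivialZeros := fun i ↦ ⟨e i, he_ntz i⟩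
  have hez_inj : Function.Injective ez := fun i j h ↦ he_inj (congrArg Subtype.val h :)
  have hYi : ∀ i, Y (ez i) = c i * κ i := fun i ↦ by
    simp only [hYdef]
    show (weilMellin G (e i)).re = c i * κ i
    rw [hGei]
    simp [Complex.mul_re]
  have hYsum : S * Real.cosh (θ * T) ^ 2 ≤
      ∑' ρ : riemannZetaNontrivialZeros, (riemannZetaZeroOrder (ρ : ℂ) : ℝ) * Y ρ ^ 2 := by
    have h1 : ∑ ρ ∈ Finset.univ.image ez, (riemannZetaZeroOrder (ρ : ℂ) : ℝ) * Y ρ ^ 2 ≤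
        ∑' ρ : riemannZetaNontrivialZeros, (riemannZetaZeroOrder (ρ : ℂ) : ℝ) * Y ρ ^ 2 :=
      hsumY.sum_le_tsum _ fun ρ _ ↦ mul_nonneg (hm0 ρ) (sq_nonneg _)
    rw [Finset.sum_image fun i _ j _ h ↦ hez_inj h] at h1
    refine le_trans ?_ h1
    rw [hSdef, Finset.sum_mul]
    refine Finset.sum_le_sum fun i _ ↦ ?_
    rw [hYi]
    have hκ := hκ1 i
    have hm := hm1 (ez i)
    have hc2 : 0 ≤ c i ^ 2 := sq_nonneg _
    calc c i ^ 2 * Real.cosh (θ * T) ^ 2 ≤ c i ^ 2 * κ i ^ 2 :=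
          mul_le_mul_of_nonneg_left (pow_le_pow_left₀ (Real.cosh_pos _).le hκ 2) hc2
      _ = 1 * (c i * κ i) ^ 2 := by ring
      _ ≤ (riemannZetaZeroOrder ((ez i : riemannZetaNontrivialZeros) : ℂ) : ℝ) * (c i * κ i) ^ 2 :=
          mul_le_mul_of_nonneg_right hm (sq_nonneg _)
  -- Step 9: conclusion `Re Q(G) ≤ S·n·E²ε·cosh²(θT) - S cosh²(θT) < 0`
  rw [hre]
  have hSc : S * ((n : ℝ) * (E ^ 2 * Real.cosh (θ * T) ^ 2 * ε)) < S * Real.cosh (θ * T) ^ 2 :=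
    mul_lt_mul_of_pos_left hnε hSpos
  linarith [hXsum, hYsum, hSc]


end Summit.RiemannHypothesis.RiemannHypothesis.Theorems.PfPersistenceM2NegIndex

end
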